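import Mathlib
import HarnessLib
import Summits.QuantumFields.YangMills.Theses.PencilRigidity
import Summits.QuantumFields.YangMills.Theorems.PencilRigidityCurvatureKernelBoundTwoPointLocalBoundScaling

/-!
# `CurvatureKernelBound` — the crux implies the local two-point decay bound (support for stmt-QuantumFields-11687)

Support file for crux `stmt-QuantumFields-11687` (`PencilRigidity.CurvatureKernelBound`), line
`sixteen-charts-analytic-kernel`, stub N′ `CruxToLocalDecay` (skeleton v15): the NECESSITY half of the
continuum characterisation `CurvatureKernelBound ↔ TwoPointLocalDecay`.

If the crux holds then every `W₁`-datum `(r, sch, S₁)` obeys the local `L¹ ⊗ L¹` two-point bound near the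
time axis: the crux's real kernel `K` satisfies `|K(ξ)| ≤ C (1 + ‖ξ‖^(η−10))` off `0`; for real Schwartz
`f 0, f 1` supported in the closed `r`-balls about `∓ s e₀` with `r ≤ s/2` the tensor `F = f 0 ⊗ f 1` is
off-diagonal, so `S₁ 2 F = ∫ K(x₀ − x₁) F`, and every contributing pair has `s ≤ ‖x₀ − x₁‖ ≤ 3s`, where
`|K| ≤ max C 0 · (1 + s^(η−10) + (3s)^(η−10)) ≤ max C 0 · (2 + 3^(η−10)) · s^(min η 10 − 10)` (`0 < s ≤ 1`).
Hence `‖S₁ 2 F‖ ≤ A (∫|f 0|)(∫|f 1|)` with `A ≤ C_T s^(η_T − 10)`, `B = 0`. [folklore]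
-/

noncomputable section

open scoped BigOperators Topology SchwartzMap ComplexConjugate
open MeasureTheory Filter Set Metric
open Literature.MathematicalPhysics.QuantumLattice Literature.MathematicalPhysics.AQFT
open Literature.MathematicalPhysics.QuantumFieldTheory

namespace Summit.QuantumFields.YangMills.Theorems.CurvatureKernel

namespace CruxToLocalDecayAux

/-- **Shell bound for the power weight.** On the shell `s ≤ t ≤ 3s` (`0 < s`):
`t^(η−10) ≤ s^(η−10) + (3s)^(η−10)` (the first term dominates for `η ≤ 10`, the second for `η ≥ 10`). [folklore] -/
theorem rpow_shell_le {η s t : ℝ} (hs : 0 < s) (hst : s ≤ t) (ht3 : t ≤ 3 * s) :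
    t ^ (η - 10) ≤ s ^ (η - 10) + (3 * s) ^ (η - 10) := by
  have h1 : 0 ≤ s ^ (η - 10) := Real.rpow_nonneg hs.le _
  have h2 : 0 ≤ (3 * s) ^ (η - 10) := Real.rpow_nonneg (by positivity) _
  rcases le_total η 10 with hη | hη
  · have : t ^ (η - 10) ≤ s ^ (η - 10) := Real.rpow_le_rpow_of_nonpos hs hst (by linarith)
    linarith
  · have : t ^ (η - 10) ≤ (3 * s) ^ (η - 10) :=
      Real.rpow_le_rpow (hs.le.trans hst) ht3 (by linarith)
    linarith

/-- **Scale comparison.** For `0 < s ≤ 1`: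
`1 + s^(η−10) + (3s)^(η−10) ≤ (2 + 3^(η−10)) · s^(min η 10 − 10)`. [folklore] -/
theorem shell_const_le {η s : ℝ} (hs : 0 < s) (hs1 : s ≤ 1) :
    1 + s ^ (η - 10) + (3 * s) ^ (η - 10) ≤ (2 + (3 : ℝ) ^ (η - 10)) * s ^ (min η 10 - 10) := by
  have h1 : (1 : ℝ) ≤ s ^ (min η 10 - 10) :=
    Real.one_le_rpow_of_pos_of_le_one_of_nonpos hs hs1 (by linarith [min_le_right η 10])
  have h2 : s ^ (η - 10) ≤ s ^ (min η 10 - 10) :=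
    Real.rpow_le_rpow_of_exponent_ge hs hs1 (by linarith [min_le_left η 10])
  have h3 : (3 * s) ^ (η - 10) = (3 : ℝ) ^ (η - 10) * s ^ (η - 10) :=
    Real.mul_rpow (by norm_num) hs.le
  have h4 : (0 : ℝ) ≤ (3 : ℝ) ^ (η - 10) := Real.rpow_nonneg (by norm_num) _
  rw [h3]
  nlinarith [mul_le_mul_of_nonneg_left h2 h4]

/-- **Product formula** `∫ |f 0 (x 0)| · |f 1 (x 1)| d(x 0, x 1) = (∫ |f 0|)(∫ |f 1|)` on `(ℝ⁴)²`. [folklore] -/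
theorem integral_abs_tensor (f : Fin 2 → 𝓢(EuclideanSpace ℝ (Fin 4), ℝ)) :
    ∫ x : Fin 2 → EuclideanSpace ℝ (Fin 4), |f 0 (x 0)| * |f 1 (x 1)| =
      (∫ y : EuclideanSpace ℝ (Fin 4), |f 0 y|) * ∫ y : EuclideanSpace ℝ (Fin 4), |f 1 y| := by
  simpa [Fin.prod_univ_two] using integral_fintype_prod_volume_eq_prod (𝕜 := ℝ)
    (E := fun _ : Fin 2 => EuclideanSpace ℝ (Fin 4))
    ![fun y => |(f 0 : 𝓢(EuclideanSpace ℝ (Fin 4), ℝ)) y|, fun y => |(f 1 : 𝓢(EuclideanSpace ℝ (Fin 4), ℝ)) y|]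

/-- **Kernel estimate off the diagonal.** If `|K ξ| ≤ A` on the shell `s ≤ ‖ξ‖ ≤ 3s`, `F = f 0 ⊗ f 1` pointwise with
`f i` supported in the closed `r`-balls about `∓ s e₀` and `r ≤ s/2`, then `‖∫ K(x 0 − x 1) F‖ ≤ A (∫|f 0|)(∫|f 1|)`
(no integrability hypothesis: a non-integrable Bochner integral is `0`). [folklore] -/
theorem norm_integral_kernel_tensor_le {K : EuclideanSpace ℝ (Fin 4) → ℝ} {s r A : ℝ} (hs : 0 < s)
    (hr : r ≤ s / 2) (hK : ∀ ξ : EuclideanSpace ℝ (Fin 4), s ≤ ‖ξ‖ → ‖ξ‖ ≤ 3 * s → |K ξ| ≤ A)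
    (f : Fin 2 → 𝓢(EuclideanSpace ℝ (Fin 4), ℝ)) {F : 𝓢((Fin 2 → EuclideanSpace ℝ (Fin 4)), ℂ)}
    (hFt : IsTensorOf F (fun i => ofRealTest (f i)))
    (hsupp₀ : tsupport ((f 0 : 𝓢(EuclideanSpace ℝ (Fin 4), ℝ)) : EuclideanSpace ℝ (Fin 4) → ℝ) ⊆
      Metric.closedBall (EuclideanSpace.single (0 : Fin 4) (-s)) r)
    (hsupp₁ : tsupport ((f 1 : 𝓢(EuclideanSpace ℝ (Fin 4), ℝ)) : EuclideanSpace ℝ (Fin 4) → ℝ) ⊆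
      Metric.closedBall (EuclideanSpace.single (0 : Fin 4) s) r) :
    ‖∫ x : Fin 2 → EuclideanSpace ℝ (Fin 4), (K (x 0 - x 1) : ℂ) * F x‖ ≤
      A * (∫ y : EuclideanSpace ℝ (Fin 4), |f 0 y|) * ∫ y : EuclideanSpace ℝ (Fin 4), |f 1 y| := by
  -- Lebesgue measure on `(ℝ⁴)²` has temperate growth (Schwartz functions are integrable)
  haveI : (volume : Measure (Fin 2 → EuclideanSpace ℝ (Fin 4))).HasTemperateGrowth :=
    Measure.IsAddHaarMeasure.instHasTemperateGrowth
  have F_apply : ∀ x : Fin 2 → EuclideanSpace ℝ (Fin 4), F x = ((f 0 (x 0) * f 1 (x 1) : ℝ) : ℂ) := by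
    intro x
    rw [hFt x, Fin.prod_univ_two, ofRealTest_apply, ofRealTest_apply, Complex.ofReal_mul]
  have norm_F : ∀ x : Fin 2 → EuclideanSpace ℝ (Fin 4), ‖F x‖ = |f 0 (x 0)| * |f 1 (x 1)| := by
    intro x
    rw [F_apply, Complex.norm_real, Real.norm_eq_abs, abs_mul]
  -- pointwise bound
  have hpt : ∀ x : Fin 2 → EuclideanSpace ℝ (Fin 4),
      ‖(K (x 0 - x 1) : ℂ) * F x‖ ≤ A * ‖F x‖ := by
    intro x
    by_cases hF0 : F x = 0
    · rw [hF0]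
      simp
    have h01 : f 0 (x 0) * f 1 (x 1) ≠ 0 := by
      intro h
      apply hF0
      rw [F_apply, h]
      simp
    obtain ⟨h0, h1⟩ := mul_ne_zero_iff.1 h01
    have hu : x 0 ∈ Metric.closedBall (EuclideanSpace.single (0 : Fin 4) (-s) : EuclideanSpace ℝ (Fin 4)) r :=
      hsupp₀ (subset_tsupport _ h0)
    have hv : x 1 ∈ Metric.closedBall (EuclideanSpace.single (0 : Fin 4) s : EuclideanSpace ℝ (Fin 4)) r :=
      hsupp₁ (subset_tsupport _ h1)
    obtain ⟨hw1, hw2⟩ := TwoPointLocal.norm_sub_mem_window_of_balls hs hr hu hv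
    rw [norm_mul, Complex.norm_real, Real.norm_eq_abs]
    exact mul_le_mul_of_nonneg_right (hK _ hw1 hw2) (norm_nonneg _)
  have hbound : Integrable (fun x : Fin 2 → EuclideanSpace ℝ (Fin 4) => A * ‖F x‖) :=
    F.integrable.norm.const_mul A
  calc ‖∫ x : Fin 2 → EuclideanSpace ℝ (Fin 4), (K (x 0 - x 1) : ℂ) * F x‖
      ≤ ∫ x : Fin 2 → EuclideanSpace ℝ (Fin 4), A * ‖F x‖ :=
        norm_integral_le_of_norm_le hbound (Eventually.of_forall hpt)
    _ = A * ∫ x : Fin 2 → EuclideanSpace ℝ (Fin 4), |f 0 (x 0)| * |f 1 (x 1)| := by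
        rw [integral_const_mul]
        congr 1
        exact integral_congr_ae (Eventually.of_forall norm_F)
    _ = A * (∫ y : EuclideanSpace ℝ (Fin 4), |f 0 y|) * ∫ y : EuclideanSpace ℝ (Fin 4), |f 1 y| := by
        rw [integral_abs_tensor, mul_assoc]

end CruxToLocalDecayAux

open CruxToLocalDecayAux SemiDegenerate TwoPointLocal in
/-- **`CruxToLocalDecay`** (Stub N′ of line `sixteen-charts-analytic-kernel`, crux `PencilRigidity.CurvatureKernelBound`,
registered signature verbatim): the crux implies the local two-point decay bound T for every `W₁`-datum — with
`η_T = min η 10`, `s₁ = 1`, `r₀ = s/2`, `A = max C 0 · (1 + s^(η−10) + (3s)^(η−10))`, `B = 0` and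
`C_T = max C 0 · (2 + 3^(η−10))`. [folklore] -/
theorem CruxToLocalDecay : open Literature.MathematicalPhysics.QuantumLattice Literature.MathematicalPhysics.AQFT Literature.MathematicalPhysics.QuantumFieldTheory in Summit.QuantumFields.YangMills.Theses.PencilRigidity.CurvatureKernelBound → ∀ (G : Type) [Group G] [TopologicalSpace G] [IsTopologicalGroup G] [CompactSpace G] [MeasurableSpace G] [BorelSpace G], IsCompactSimpleLieGroup G → ∀ (r : LatticeRep G) (sch : SpeciesScheme (YMSpecies G)) (S₁ : SchwingerFamily (EuclideanSpace ℝ (Fin 4))), ((∀ (n : ℕ), n ≠ 0 → ∀ (f : Fin n → SchwartzMap (EuclideanSpace ℝ (Fin 4)) ℝ) (F : SchwartzMap (Fin n → (EuclideanSpace ℝ (Fin 4))) ℂ), IsTensorOf F (fun i => ofRealTest (f i)) → IsOffDiagonal F → Filter.Tendsto (fun k : ℕ => ((latticeSchwinger r.ρ sch (fun s => s.F) k n (fun _ => r.curvature) f : ℝ) : ℂ)) Filter.atTop (nhds (S₁ n F))) ∧ (S₁.toLabelled.IsNormalized ∧ S₁.toLabelled.IsHermitian ∧ S₁.toLabelled.HasLinearGrowth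 ∧ S₁.toLabelled.IsReflectionPositive ∧ S₁.toLabelled.IsSymmetric ∧ S₁.toLabelled.HasClusterProperty) ∧ (∀ (n : ℕ) (a : (EuclideanSpace ℝ (Fin 4))) (F : SchwartzMap (Fin n → (EuclideanSpace ℝ (Fin 4))) ℂ), IsOffDiagonal F → S₁ n (translateMulti a F) = S₁ n F) ∧ (∀ (R : (EuclideanSpace ℝ (Fin 4)) ≃ₗᵢ[ℝ] (EuclideanSpace ℝ (Fin 4))), LinearMap.det (R.toLinearEquiv : (EuclideanSpace ℝ (Fin 4)) →ₗ[ℝ] (EuclideanSpace ℝ (Fin 4))) = 1 → (∀ i : Fin 4, ∃ j : Fin 4, R (EuclideanSpace.single i 1) = EuclideanSpace.single j 1 ∨ R (EuclideanSpace.single i 1) = -EuclideanSpace.single j 1) → ∀ (n : ℕ) (F : SchwartzMap (Fin n → (EuclideanSpace ℝ (Fin 4))) ℂ), IsOffDiagonal F → S₁ n (linActMulti R F) = S₁ n F) ∧ (∃ Δ : ℝ, 0 < Δ ∧ S₁.toLabelled.HasMassGap Δ ∧ HasLatticeMassGap r sch Δ)) → ∃ (C η s₁ : ℝ), 0 < η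 ∧ 0 < s₁ ∧ (∀ (s : ℝ), 0 < s → s < s₁ → ∃ (r₀ A B : ℝ), 0 < r₀ ∧ 0 ≤ A ∧ 0 ≤ B ∧ A + B ≤ C * s ^ (η - 10) ∧ (∀ (r : ℝ), 0 < r → r ≤ r₀ → ∀ (f : Fin 2 → SchwartzMap (EuclideanSpace ℝ (Fin 4)) ℝ) (F : SchwartzMap (Fin 2 → (EuclideanSpace ℝ (Fin 4))) ℂ) (M₀ M₁ : ℝ), IsTensorOf F (fun i => ofRealTest (f i)) → tsupport ((f 0 : SchwartzMap (EuclideanSpace ℝ (Fin 4)) ℝ) : (EuclideanSpace ℝ (Fin 4)) → ℝ) ⊆ Metric.closedBall (EuclideanSpace.single (0 : Fin 4) (-s)) r → tsupport ((f 1 : SchwartzMap (EuclideanSpace ℝ (Fin 4)) ℝ) : (EuclideanSpace ℝ (Fin 4)) → ℝ) ⊆ Metric.closedBall (EuclideanSpace.single (0 : Fin 4) s) r → (∀ x, |f 0 x| ≤ M₀) → (∀ x, |f 1 x| ≤ M₁) → ‖S₁ 2 F‖ ≤ A * (∫ x : (EuclideanSpace ℝ (Fin 4)), |f 0 x|) *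 (∫ x : (EuclideanSpace ℝ (Fin 4)), |f 1 x|) + B * r ^ 8 * M₀ * M₁)) := by
  intro hcrux G i1 i2 i3 i4 i5 i6 hG r sch S₁ hW₁
  -- the crux fixes the Borel σ-algebra by `letI := borel G`; ours is (propositionally) the same
  have hm : i5 = borel G := BorelSpace.measurable_eq
  subst hm
  obtain ⟨K, C, η, hη, -, hbd, hrep⟩ := hcrux G hG r sch S₁ hW₁
  have hC : C ≤ max C 0 := le_max_left _ _
  have hC0 : 0 ≤ max C 0 := le_max_right _ _
  refine ⟨max C 0 * (2 + (3 : ℝ) ^ (η - 10)), min η 10, 1, lt_min hη (by norm_num), one_pos,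
    fun s hs hs1 => ?_⟩
  -- the shell constant `A = max C 0 · (1 + s^(η−10) + (3s)^(η−10))`
  have hshell : 0 ≤ 1 + s ^ (η - 10) + (3 * s) ^ (η - 10) := by positivity
  refine ⟨s / 2, max C 0 * (1 + s ^ (η - 10) + (3 * s) ^ (η - 10)), 0, half_pos hs,
    mul_nonneg hC0 hshell, le_rfl, ?_, ?_⟩
  · -- `A + 0 ≤ C_T · s^(min η 10 − 10)`
    rw [add_zero, mul_assoc]
    exact mul_le_mul_of_nonneg_left (shell_const_le hs hs1.le) hC0
  · intro ρ hρ hρs f F _ _ hFt hsupp₀ hsupp₁ _ _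
    -- the two closed balls are disjoint, so `F` is off-diagonal and the crux's kernel represents `S₁ 2 F`
    have hdisj : Disjoint (tsupport ((f 0 : 𝓢(EuclideanSpace ℝ (Fin 4), ℝ)) : EuclideanSpace ℝ (Fin 4) → ℝ))
        (tsupport ((f 1 : 𝓢(EuclideanSpace ℝ (Fin 4), ℝ)) : EuclideanSpace ℝ (Fin 4) → ℝ)) :=
      Disjoint.mono hsupp₀ hsupp₁ (disjoint_closedBall_single hs hρs)
    have hFoff : IsOffDiagonal F := isOffDiagonal_of_isTensorOf_of_disjoint hFt hdisj
    obtain ⟨-, hSF⟩ := hrep F hFoff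
    -- `|K| ≤ A` on the shell `s ≤ ‖ξ‖ ≤ 3s`
    have hK : ∀ ξ : EuclideanSpace ℝ (Fin 4), s ≤ ‖ξ‖ → ‖ξ‖ ≤ 3 * s →
        |K ξ| ≤ max C 0 * (1 + s ^ (η - 10) + (3 * s) ^ (η - 10)) := by
      intro ξ h1 h2
      have hξ : ξ ≠ 0 := by
        intro h0
        rw [h0, norm_zero] at h1
        linarith
      have hpos : 0 ≤ 1 + ‖ξ‖ ^ (η - 10) := by positivity
      calc |K ξ| ≤ C * (1 + ‖ξ‖ ^ (η - 10)) := hbd ξ hξ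
        _ ≤ max C 0 * (1 + ‖ξ‖ ^ (η - 10)) := mul_le_mul_of_nonneg_right hC hpos
        _ ≤ max C 0 * (1 + s ^ (η - 10) + (3 * s) ^ (η - 10)) := by
            refine mul_le_mul_of_nonneg_left ?_ hC0
            linarith [rpow_shell_le (η := η) hs h1 h2]
    rw [hSF, zero_mul, zero_mul, zero_mul, add_zero]
    exact norm_integral_kernel_tensor_le hs hρs hK f hFt hsupp₀ hsupp₁

end Summit.QuantumFields.YangMills.Theorems.CurvatureKernel

end
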